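import Summits.BirchSwinnertonDyer.BirchSwinnertonDyer.Theorems.GenusKolyvaginAtTwoPowDvdShaCardAtTwoRTGenusClasses
import HarnessLib

/-!
# Route `GenusKolyvaginAtTwo`, LINE 18 (L_T `PowDvdShaCardAtTwoRT`, stmt-BirchSwinnertonDyer-23242): THE GENUS KERNEL —
# `ker(H¹(F, E) → H¹(L, E_L)) = 0 ⟺ every anti-invariant point of E(L) is τR − R`, and the genus class of a Mordell–Weil generator

Seat `bsd-line-gk2-p2` g17 (cell `bsd-f1-sign2`), `--supports stmt-BirchSwinnertonDyer-23242` (helper; closes nothing).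
THEOREMS ONLY (no definition, no named fact, no `sorry`); BSD is not proved by any of this.

WHY.  In the bookkeeping of LINE 18 (Deep regime after the death of stub J; the relaxed genus budgets `[res⁻¹Ш(X_K) : Ш(X)] ≤ 2^B`;
gk2-p3's J_K count `#A⁺·#A⁻ = #A·#H¹(C₂,A)`; gk2-p4's defect-rank frame) the subgroup of `H¹(ℚ, X)` that DIES over `K` — the inflation of
`H¹(Gal(K/ℚ), X(K)) = X(K)⁻/(τ−1)X(K)` — is where the genus classes live («the −1 in `e = B − 1` is the Heegner point's own genus class»,
pen v4).  `…RTGenusClasses` (p697517) SUPPLIES such classes from anti-invariant points; this file gives the CONVERSE and the habitat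
readings, at the level of an arbitrary field `F` of characteristic `0` and a quadratic `L/F` with non-trivial automorphism `τ`:

* §1 `exists_indexTwo_setup` — the common stage (`N = Γ_L ⊴ Γ_F` open of index `2`, coset generator `σ`, invariants `S = E(L)` embedded
  `τ`-equivariantly: `σ • ι R = ι (τ R)`), packaged once;
  `exists_antiInvariant_of_mem_localRestrictionKer` — EVERY class dying over `L` is the genus class of an anti-invariant point: for
  `c ∈ ker` there is `Q ∈ E(L)` with `τQ = −Q` such that `c = 0 ⟺ Q ∈ (τ−1)E(L)` … stated as the two usable consequences:
  **`localRestrictionKer_eq_bot_of_forall_antiInvariant`** (if every anti-invariant point is `τR − R` then `H¹(F,E) → H¹(L,E_L)` is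
  INJECTIVE — generalises gk2-p3's `localRestrictionKer_eq_bot_of_finrank_eq_two`, whose uniquely-2-divisible `E(L)` has `Q = τ(−Q/2) − (−Q/2)`)
  and **`exists_ne_zero_mem_localRestrictionKer_of_antiInvariant`** (an anti-invariant point outside `(τ−1)E(L)` gives a non-zero class of
  order `2` in the kernel); together `localRestrictionKer_eq_bot_iff`.
* §2 `mul_self_eq_one_of_ne_one` (`τ² = 1`), **`forall_ne_sub_of_fixed_odd`** — the HABITAT criterion: if the `τ`-FIXED points of `E(L)` are
  odd torsion (`E(ℚ)` on the GK2 habitat) then `(τ−1)E(L) ⊆ 2E(L) + E(L)_{odd}`, so an anti-invariant `y` none of whose odd multiples is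
  `2`-divisible (the Mordell–Weil generator of `E(K)`, rank `1`) is NOT in `(τ−1)E(L)`; hence
  **`exists_ne_zero_mem_localRestrictionKer_of_generator`**: the genus class `x_y ≠ 0`, `2x_y = 0`, dies over `L`.
* §3 number fields: **`natCard_localRestrictionKer_eq_two`** — `K/k` Galois quadratic number fields, `E(K)[2] = 0`, `rank E(K) = 1` and such a
  `y`: `#ker(H¹(k,E) → H¹(K,E_K)) = 2` EXACTLY (`≤ 2^{rank}` is gk2-p3's `natCard_localRestrictionKer_le_two_pow_mordellWeilRank`; `≥ 2` by `x_y`).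
  On the GK2 habitat (`W(ℚ)` odd, `rank W(K) = 1`, `W(K)[2] = 0`): the W-side relaxed group `res⁻¹Ш(W_K)` contains EXACTLY ONE non-trivial
  class dying over `K`; for the twin `Wd` (anti-invariants = `W(ℚ)`, odd, all norms) §1 gives NO class dying over `K`.

References: [SerreLocalFields1979] VIII.§4; [SerreGaloisCohomology1997] I.§2.4, I.§5.8; [Kramer1981] §3 (proof of Thm. 2), §5 Prop. 8;
[GrossLMS1991] §1 (habitat).
-/

set_option autoImplicit false
-- the Theorems namespace of this sub repeats the summit name by design (D-0017 nested layout)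
set_option linter.dupNamespace false

noncomputable section

open scoped Classical

namespace Summit.BirchSwinnertonDyer.BirchSwinnertonDyer.Theorems.GenusExact.PlusDescent

open Literature.NumberTheory.EllipticCurves Literature.NumberTheory.GaloisRepresentations
open WeierstrassCurve IntermediateField Literature.Barriers.BirchSwinnertonDyer

universe u

/-! ## §1 The genus kernel of a quadratic extension -/

section Field

variable {F : Type u} [Field F] [CharZero F] (W : WeierstrassCurve F) (L : Type u) [Field L] [Algebra F L]
  [FiniteDimensional F L]

/-- **The index-two stage, packaged.**  For `[L : F] = 2` with non-trivial `τ ∈ Aut(L/F)`: the open normal subgroup `N = galRange L ≤ Γ_F`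
of index `2`, a coset generator `σ`, and the subgroup `S` of `N`-invariant geometric points together with an injective additive embedding
`ι : E(L) → E(F̄)` onto `S` which is `τ`-equivariant: `σ • ι R = ι (τ R)` (`σ ∘ j = j ∘ τ` on the copy `j(L) ⊆ F̄`,
`algHom_comp_eq_comp_of_not_mem_galRange`). [cite: SerreGaloisCohomology1997, II.§1.1 and I.§5.8] -/
theorem exists_indexTwo_setup (h2 : Module.finrank F L = 2) (τ : L ≃ₐ[F] L) (hτ : τ ≠ 1) :
    ∃ (σ : Field.absoluteGaloisGroup F) (S : AddSubgroup (geomPoints W))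
      (ι : (W.baseChange L).toAffine.Point →+ geomPoints W),
      (galRange (K := F) L).Normal ∧ IsOpen (galRange (K := F) L : Set (Field.absoluteGaloisGroup F)) ∧
      (galRange (K := F) L).index = 2 ∧ (∀ b, Xor (b * σ ∈ galRange (K := F) L) (b ∈ galRange (K := F) L)) ∧
      (∀ P : geomPoints W, P ∈ S ↔ ∀ n ∈ galRange (K := F) L, n • P = P) ∧
      Function.Injective ι ∧ (∀ P, P ∈ S ↔ ∃ R, ι R = P) ∧
      ∀ R, σ • ι R = ι (WeierstrassCurve.Affine.Point.map (W' := W) (τ : L →ₐ[F] L) R) := by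
  haveI : Algebra.IsAlgebraic F L := Algebra.IsAlgebraic.of_finite F L
  haveI : IsGalois F (AlgebraicClosure F) := {}
  set e : AlgebraicClosure F ≃ₐ[F] AlgebraicClosure L := algEquivOfEmb L (closureEmb (K := F) L) with he
  set j : L →ₐ[F] AlgebraicClosure F :=
    ((e.symm : AlgebraicClosure L →ₐ[F] AlgebraicClosure F).comp
      (IsScalarTower.toAlgHom F L (AlgebraicClosure L))) with hj
  set F' : IntermediateField F (AlgebraicClosure F) := j.fieldRange with hF'
  set N : Subgroup (Field.absoluteGaloisGroup F) := galRange (K := F) L with hNdef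
  have hN : N = F'.fixingSubgroup := galRange_eq_fixingSubgroup_fieldRange L
  let eL : L ≃ₐ[F] F' := AlgHom.equivFieldRange j
  haveI : FiniteDimensional F F' := LinearEquiv.finiteDimensional eL.toLinearEquiv
  have hNopen : IsOpen (N : Set (Field.absoluteGaloisGroup F)) := by
    rw [hN]; exact IntermediateField.fixingSubgroup_isOpen F'
  have hidx : N.index = 2 := by
    rw [hN]
    refine ((IntermediateField.finrank_eq_fixingSubgroup_index F').symm.trans ?_)
    rw [← eL.toLinearEquiv.finrank_eq, h2]
  haveI hNn : N.Normal := Subgroup.normal_of_index_eq_two hidx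
  obtain ⟨σ, hσ⟩ := Subgroup.index_eq_two_iff.mp hidx
  have hσN : σ ∉ N := not_mem_of_xor_mul hσ
  set m : (W.baseChange F').toAffine.Point →+ geomPoints W :=
    WeierstrassCurve.Affine.Point.map (W' := W) (F'.val : F' →ₐ[F] AlgebraicClosure F) with hm
  have hminj : Function.Injective m := WeierstrassCurve.Affine.Point.map_injective _
  set S : AddSubgroup (geomPoints W) := m.range with hSdef
  have hS : ∀ P : geomPoints W, P ∈ S ↔ ∀ n ∈ N, n • P = P := by
    intro P
    rw [hN]
    refine ⟨?_, mem_range_map_val_of_forall_smul_eq W F' P⟩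
    rintro ⟨Q', rfl⟩ τ' hτ'
    exact smul_eq_of_map_val_eq W F' Q' _ rfl hτ'
  let m₁ : (W.baseChange L).toAffine.Point →+ (W.baseChange F').toAffine.Point :=
    WeierstrassCurve.Affine.Point.map (W' := W) (eL : L →ₐ[F] F')
  have hm₁ : Function.Bijective m₁ := by
    refine ⟨WeierstrassCurve.Affine.Point.map_injective _, fun Q' ↦
      ⟨WeierstrassCurve.Affine.Point.map (W' := W) (eL.symm : F' →ₐ[F] L) Q', ?_⟩⟩
    change WeierstrassCurve.Affine.Point.map _ (WeierstrassCurve.Affine.Point.map _ Q') = Q'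
    rw [WeierstrassCurve.Affine.Point.map_map, AlgEquiv.comp_symm]
    cases Q' <;> rfl
  have hjval : (F'.val : F' →ₐ[F] AlgebraicClosure F).comp (eL : L →ₐ[F] F') = j := by
    ext x
    exact AlgHom.equivFieldRange_apply_coe j x
  have hmm₁ : ∀ R : (W.baseChange L).toAffine.Point, m (m₁ R) = WeierstrassCurve.Affine.Point.map (W' := W) j R := by
    intro R
    change WeierstrassCurve.Affine.Point.map _ (WeierstrassCurve.Affine.Point.map _ R) = _
    rw [WeierstrassCurve.Affine.Point.map_map, hjval]
  have hστ : ∀ R : (W.baseChange L).toAffine.Point,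
      σ • m (m₁ R) = m (m₁ (WeierstrassCurve.Affine.Point.map (W' := W) (τ : L →ₐ[F] L) R)) := by
    intro R
    rw [hmm₁, hmm₁]
    change WeierstrassCurve.Affine.Point.map
      ((show AlgebraicClosure F ≃ₐ[F] AlgebraicClosure F from σ) : AlgebraicClosure F →ₐ[F] AlgebraicClosure F)
        (WeierstrassCurve.Affine.Point.map (W' := W) j R) = _
    rw [WeierstrassCurve.Affine.Point.map_map, WeierstrassCurve.Affine.Point.map_map, hj,
      algHom_comp_eq_comp_of_not_mem_galRange L h2 τ hτ hσN]
  refine ⟨σ, S, m.comp m₁, hNn, hNopen, hidx, hσ, hS, hminj.comp hm₁.1, fun P ↦ ?_, fun R ↦ hστ R⟩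
  constructor
  · rintro ⟨B, rfl⟩
    obtain ⟨R, rfl⟩ := hm₁.2 B
    exact ⟨R, rfl⟩
  · rintro ⟨R, rfl⟩
    exact ⟨m₁ R, rfl⟩

/-- **`H¹(F, E) → H¹(L, E_L)` is injective when every anti-invariant point is `τR − R`** (`L/F` quadratic, `F` of characteristic `0`,
`τ ≠ 1`): a class dying over `L` is inflated from a cocycle `f` vanishing on `Γ_L` (`resKer_le_range_inflClass`); its value `f(σ) ∈ E(L)` is
ANTI-invariant (`smul_apply_eq_neg_apply`), hence `= τR − R` by hypothesis, so `[f] = 0` (`inflClass_eq_zero_iff_exists_smul_sub`).  This is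
`H¹(Gal(L/F), E(L)) = E(L)⁻/(τ−1)E(L) = 0`.  gk2-p3's `localRestrictionKer_eq_bot_of_finrank_eq_two` is the case of uniquely `2`-divisible
`E(L)` (`Q = τ(−Q/2) − (−Q/2)`). [cite: SerreLocalFields1979, VIII.§4] [cite: Kramer1981, §3 (proof of Thm. 2)] -/
theorem localRestrictionKer_eq_bot_of_forall_antiInvariant (h2 : Module.finrank F L = 2) (τ : L ≃ₐ[F] L) (hτ : τ ≠ 1)
    (h : ∀ Q : (W.baseChange L).toAffine.Point, WeierstrassCurve.Affine.Point.map (W' := W) (τ : L →ₐ[F] L) Q = -Q →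
      ∃ R : (W.baseChange L).toAffine.Point, Q = WeierstrassCurve.Affine.Point.map (W' := W) (τ : L →ₐ[F] L) R - R) :
    W.localRestrictionKer L = ⊥ := by
  haveI : Algebra.IsAlgebraic F L := Algebra.IsAlgebraic.of_finite F L
  obtain ⟨σ, S, ι, hNn, hNopen, -, hσ, hS, hιinj, hιS, hστ⟩ := exists_indexTwo_setup W L h2 τ hτ
  haveI := hNn
  rw [eq_bot_iff]
  intro c hc
  obtain ⟨f, hf⟩ := resKer_le_range_inflClass (resGal (K := F) L) (pointsMap W L) (pointsMap_smul W L)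
    (pointsMapOfEmb_bijective L W _) (galRange (K := F) L) hNopen le_rfl hc
  rw [AddSubgroup.mem_bot, ← hf, inflClass_eq_zero_iff_exists_smul_sub hNopen hσ hS f]
  -- `f σ = ι Q` with `Q` anti-invariant
  obtain ⟨Q, hQ⟩ := (hιS (f.1 σ)).mp (apply_mem_of_invariants hS f σ)
  have hanti : σ • f.1 σ = -f.1 σ := smul_apply_eq_neg_apply hσ f
  rw [← hQ, hστ, ← map_neg] at hanti
  obtain ⟨R, hR⟩ := h Q (hιinj hanti)
  refine ⟨ι R, (hιS _).mpr ⟨R, rfl⟩, ?_⟩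
  rw [← hQ, hR, map_sub, hστ]

/-- **An anti-invariant point outside `(τ−1)E(L)` gives a non-zero class of order `2` dying over `L`** (the genus class `x_Q` of
`…RTGenusClasses.exists_genusClasses` with `ι = Fin 1`). [cite: SerreLocalFields1979, VIII.§4] [cite: Kramer1981, §5 Prop. 8] -/
theorem exists_ne_zero_mem_localRestrictionKer_of_antiInvariant (h2 : Module.finrank F L = 2) (τ : L ≃ₐ[F] L) (hτ : τ ≠ 1)
    (Q : (W.baseChange L).toAffine.Point) (hQ : WeierstrassCurve.Affine.Point.map (W' := W) (τ : L →ₐ[F] L) Q = -Q)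
    (hQ' : ∀ R : (W.baseChange L).toAffine.Point, Q ≠ WeierstrassCurve.Affine.Point.map (W' := W) (τ : L →ₐ[F] L) R - R) :
    ∃ c ∈ W.localRestrictionKer L, c ≠ 0 ∧ 2 • c = 0 := by
  obtain ⟨x, hres, h2x, hrel⟩ := exists_genusClasses W L h2 τ hτ (fun _ : Fin 1 ↦ Q) fun _ ↦ hQ
  refine ⟨x 0, (mem_ker_resBaseChange_iff W L _).mp (hres 0), fun hx0 ↦ ?_, h2x 0⟩
  obtain ⟨R, hR⟩ := (hrel fun _ ↦ 1).mp (by simp [hx0])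
  simp only [one_smul, Finset.univ_unique, Fin.default_eq_zero, Finset.sum_singleton] at hR
  exact hQ' R hR

/-- **THE GENUS KERNEL CRITERION**: `ker(H¹(F, E) → H¹(L, E_L)) = 0 ⟺` every anti-invariant point of `E(L)` lies in `(τ−1)E(L)`
(`L/F` quadratic, characteristic `0`, `τ ≠ 1`). [cite: SerreLocalFields1979, VIII.§4] [cite: Kramer1981, §3 and §5 Prop. 8] -/
theorem localRestrictionKer_eq_bot_iff (h2 : Module.finrank F L = 2) (τ : L ≃ₐ[F] L) (hτ : τ ≠ 1) :
    W.localRestrictionKer L = ⊥ ↔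
      ∀ Q : (W.baseChange L).toAffine.Point, WeierstrassCurve.Affine.Point.map (W' := W) (τ : L →ₐ[F] L) Q = -Q →
        ∃ R : (W.baseChange L).toAffine.Point, Q = WeierstrassCurve.Affine.Point.map (W' := W) (τ : L →ₐ[F] L) R - R := by
  refine ⟨fun hbot Q hQ ↦ ?_, localRestrictionKer_eq_bot_of_forall_antiInvariant W L h2 τ hτ⟩
  by_contra hne
  have hne' : ∀ R : (W.baseChange L).toAffine.Point,
      Q ≠ WeierstrassCurve.Affine.Point.map (W' := W) (τ : L →ₐ[F] L) R - R := fun R h ↦ hne ⟨R, h⟩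
  obtain ⟨c, hc, hc0, -⟩ := exists_ne_zero_mem_localRestrictionKer_of_antiInvariant W L h2 τ hτ Q hQ hne'
  rw [hbot, AddSubgroup.mem_bot] at hc
  exact hc0 hc

/-! ## §2 The habitat criterion: fixed points odd ⇒ the generator's genus class is non-zero -/

omit [CharZero F] in
/-- A non-trivial automorphism of a quadratic extension is an involution (`#Aut(L/F) ≤ [L:F] = 2`). [folklore] -/
theorem mul_self_eq_one_of_ne_one (h2 : Module.finrank F L = 2) (τ : L ≃ₐ[F] L) (hτ : τ ≠ 1) : τ * τ = 1 := by
  by_contra hne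
  have hτ2 : τ * τ ≠ τ := fun h ↦ hτ (by simpa using congrArg (· * τ⁻¹) h)
  have h3 : ({τ * τ, τ, 1} : Finset (L ≃ₐ[F] L)).card = 3 := by
    rw [Finset.card_insert_of_notMem, Finset.card_insert_of_notMem, Finset.card_singleton]
    · simpa only [Finset.mem_singleton] using hτ
    · simp only [Finset.mem_insert, Finset.mem_singleton, not_or]
      exact ⟨hτ2, hne⟩
  have hle := (Finset.card_le_univ ({τ * τ, τ, 1} : Finset (L ≃ₐ[F] L))).trans (AlgEquiv.card_le (F := F) (K := L))
  rw [h3, h2] at hle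
  omega

omit [CharZero F] in
/-- **`(τ−1)E(L) ⊆ 2E(L) + E(L)_{odd}` when the fixed points are odd torsion.**  If every `τ`-fixed point of `E(L)` is killed by an odd
integer, and `y` is a point none of whose ODD multiples is `2`-divisible (`k • y ∉ 2E(L)` for odd `k` — e.g. a generator of `E(L)` modulo
torsion in rank one), then `y ∉ (τ−1)E(L)`: from `y = τR − R`, `P := τR + R` is fixed, `kP = 0` with `k` odd, and `k y = −2kR`.
(GK2 habitat: `E(L)^τ = E(ℚ)` is odd torsion.) [cite: GrossLMS1991, §1] [cite: Kramer1981, §1 (E(F), E^{(d)}(F) as eigenspaces)] -/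
theorem forall_ne_sub_of_fixed_odd (h2 : Module.finrank F L = 2) (τ : L ≃ₐ[F] L) (hτ : τ ≠ 1)
    (hfix : ∀ P : (W.baseChange L).toAffine.Point, WeierstrassCurve.Affine.Point.map (W' := W) (τ : L →ₐ[F] L) P = P →
      ∃ k : ℕ, Odd k ∧ k • P = 0)
    (y : (W.baseChange L).toAffine.Point) (hy2 : ∀ k : ℕ, Odd k → ∀ R : (W.baseChange L).toAffine.Point, (k : ℤ) • y ≠ 2 • R) :
    ∀ R : (W.baseChange L).toAffine.Point, y ≠ WeierstrassCurve.Affine.Point.map (W' := W) (τ : L →ₐ[F] L) R - R := by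
  intro R hR
  set φ : (W.baseChange L).toAffine.Point →+ (W.baseChange L).toAffine.Point :=
    WeierstrassCurve.Affine.Point.map (W' := W) (τ : L →ₐ[F] L) with hφ
  have hττ : ∀ P, φ (φ P) = P := by
    intro P
    change WeierstrassCurve.Affine.Point.map _ (WeierstrassCurve.Affine.Point.map _ P) = P
    rw [WeierstrassCurve.Affine.Point.map_map]
    have h1 : ((τ : L →ₐ[F] L)).comp (τ : L →ₐ[F] L) = ((τ * τ : L ≃ₐ[F] L) : L →ₐ[F] L) := rfl
    rw [h1, mul_self_eq_one_of_ne_one L h2 τ hτ]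
    cases P <;> rfl
  -- `P := τR + R` is fixed
  obtain ⟨k, hk, hkP⟩ := hfix (φ R + R) (by rw [map_add, hττ, add_comm])
  refine hy2 k hk (-((k : ℤ) • R)) ?_
  -- `k • y = k • (τR − R) = k • (τR + R) − 2k • R = −2k • R`
  have hkP' : (k : ℤ) • φ R + (k : ℤ) • R = 0 := by rw [← smul_add, natCast_zsmul]; exact hkP
  rw [hR, smul_sub, eq_neg_of_add_eq_zero_left hkP', two_nsmul]
  abel

/-- **The genus class of a Mordell–Weil generator.**  `L/F` quadratic (characteristic `0`), `τ ≠ 1`; if the `τ`-fixed points of `E(L)` are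
odd torsion and `y ∈ E(L)` is anti-invariant with no odd multiple `2`-divisible, then `ker(H¹(F, E) → H¹(L, E_L))` contains a NON-ZERO class
of order `2` — the genus class `x_y`.  (Habitat: `W(ℚ)` odd, `rank W(K) = 1`, `y` a generator modulo torsion: the «−1» of the genus index
law `e = B − 1` is this class.) [cite: Kramer1981, §5 Prop. 8] [cite: GrossLMS1991, §1] -/
theorem exists_ne_zero_mem_localRestrictionKer_of_generator (h2 : Module.finrank F L = 2) (τ : L ≃ₐ[F] L) (hτ : τ ≠ 1)
    (hfix : ∀ P : (W.baseChange L).toAffine.Point, WeierstrassCurve.Affine.Point.map (W' := W) (τ : L →ₐ[F] L) P = P →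
      ∃ k : ℕ, Odd k ∧ k • P = 0)
    (y : (W.baseChange L).toAffine.Point) (hy : WeierstrassCurve.Affine.Point.map (W' := W) (τ : L →ₐ[F] L) y = -y)
    (hy2 : ∀ k : ℕ, Odd k → ∀ R : (W.baseChange L).toAffine.Point, (k : ℤ) • y ≠ 2 • R) :
    ∃ c ∈ W.localRestrictionKer L, c ≠ 0 ∧ 2 • c = 0 :=
  exists_ne_zero_mem_localRestrictionKer_of_antiInvariant W L h2 τ hτ y hy (forall_ne_sub_of_fixed_odd W L h2 τ hτ hfix y hy2)

end Field

/-! ## §3 Number fields: the kernel has EXACTLY two elements in rank one -/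

section NumberField

open NumberField

variable {k : Type} [Field k] [NumberField k] (W : WeierstrassCurve k) [W.IsElliptic]
  (K : Type) [Field K] [NumberField K] [Algebra k K]

/-- **`#ker(H¹(k, E) → H¹(K, E_K)) = 2` on the rank-one habitat.**  `K/k` Galois quadratic number fields, `E(K)[2] = 0`,
`rank_ℤ E(K) = 1`, non-trivial `τ ∈ Gal(K/k)`, the `τ`-fixed points odd torsion, and `y ∈ E(K)` anti-invariant with no odd multiple
`2`-divisible: then the kernel is `{0, x_y}` — `≤ 2^{rank} = 2` by gk2-p3's `natCard_localRestrictionKer_le_two_pow_mordellWeilRank`, `≥ 2`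
by the genus class.  (GK2 habitat: `k = ℚ`, `K` the Heegner field, `W(ℚ)` of odd order, `y` a generator of `W(K)` modulo torsion.)
[cite: Kramer1981, proof of Thm. 2 and §5 Prop. 8] [cite: GrossLMS1991, §1] -/
theorem natCard_localRestrictionKer_eq_two [IsGalois k K] (h2 : Module.finrank k K = 2)
    (hK2 : ∀ P : (W.baseChange K).toAffine.Point, 2 • P = 0 → P = 0) (hrank : (W.baseChange K).mordellWeilRank = 1)
    (τ : K ≃ₐ[k] K) (hτ : τ ≠ 1)
    (hfix : ∀ P : (W.baseChange K).toAffine.Point, WeierstrassCurve.Affine.Point.map (W' := W) (τ : K →ₐ[k] K) P = P →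
      ∃ n : ℕ, Odd n ∧ n • P = 0)
    (y : (W.baseChange K).toAffine.Point) (hy : WeierstrassCurve.Affine.Point.map (W' := W) (τ : K →ₐ[k] K) y = -y)
    (hy2 : ∀ n : ℕ, Odd n → ∀ R : (W.baseChange K).toAffine.Point, (n : ℤ) • y ≠ 2 • R) :
    Nat.card (W.localRestrictionKer K) = 2 := by
  haveI : FiniteDimensional k K := Module.Finite.of_restrictScalars_finite ℚ k K
  haveI : Finite (W.localRestrictionKer K) := (finite_localRestrictionKer_numberField W K).to_subtype
  have hle : Nat.card (W.localRestrictionKer K) ≤ 2 := by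
    have h := natCard_localRestrictionKer_le_two_pow_mordellWeilRank W K h2 hK2
    rwa [hrank, pow_one] at h
  obtain ⟨c, hc, hc0, -⟩ := exists_ne_zero_mem_localRestrictionKer_of_generator W K h2 τ hτ hfix y hy hy2
  -- two distinct elements `0, c`
  have hge : 2 ≤ Nat.card (W.localRestrictionKer K) := by
    have h1 : (1 : ℕ) < Nat.card (W.localRestrictionKer K) := by
      rw [Finite.one_lt_card_iff_nontrivial]
      exact ⟨⟨⟨c, hc⟩, ⟨0, AddSubgroup.zero_mem _⟩, fun h ↦ hc0 (congrArg Subtype.val h)⟩⟩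
    omega
  omega

end NumberField

end Summit.BirchSwinnertonDyer.BirchSwinnertonDyer.Theorems.GenusExact.PlusDescent

end
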